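import Mathlib

/-!
# The two-status union row from conditional positive association — the algebra on the 9-vector
(blind cell PercRepro2, mine-1 g39; proofs/MINE1-UNIONROW2.md §3)

The status law of two observed vertices `u, v` on `{s ↮ t}` is a nonnegative function `M` on the
grid `{T < N < S}² = Fin 3 × Fin 3` (codes `0 = T`, `1 = N`, `2 = S`; `(2, 0) = (S, T)` is the
double-hit cell `u ∈ C_s, v ∈ C_t`). The union row of row 2′CON-U for `X ∋ u`, `Y ∋ v` (not both
`{u, v}`) restricts the covariance sum to all cells but `(S, T)`; for up-set indicators
`f = 1_A, g = 1_B` and `Z = ΣM` it reads (times `Z²`)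

  `Z·(Z·M(A∩B) − M(A)M(B)) − M(S,T)·(Z·1_A(S,T) − M(A))·(Z·1_B(S,T) − M(B)) ≥ 0`.

THEOREM `single_exclusion_nonneg`: this follows from three positive-association facts about `M`
alone — (Q) up-sets are positively associated under `M` (BHK06's (Z)-PA on `{s ↮ t}`),
(R) up-sets inside `{v ≠ T}` are positively associated under `M` restricted there
((Z)-PA given `t ↮ {s, v}`), (R′) down-sets inside `{u ≠ S}` are positively associated under `M`
restricted there ((Z)-PA given `s ↮ {t, u}`). The proof is the case analysis of
MINE1-UNIONROW2.md §3: an up-set not containing `(S, T)` lies inside `{v ≠ T}`; a down-set not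
containing `(S, T)` lies inside `{u ≠ S}`; and `(Z + M(S,T))·M(R) ≤ Z²`.

This file is pure algebra on `M` (no percolation); the identification of the row with the
9-vector form is `BoxUnionPair.sum_pairLaw_mul` + `mem_boxUnion_iff` (the status law `pairLaw`
on the grid `PairTP2.iota`), and the three hypotheses are theorems modulo the (Z)-form of
`CondAvoid.pa_given_avoid` (IF RE-SEATED in MINE1-UNIONROW2.md §5).
-/

namespace Summit.Ventures.PercRepro2

namespace UnionRowMech

open Finset

/-- The status grid `{T < N < S}²` with the product order. -/
abbrev Grid := Fin 3 × Fin 3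

/-- The mass of a set of cells. -/
def mass (M : Grid → ℝ) (A : Finset Grid) : ℝ := ∑ k ∈ A, M k

/-- The total mass `Z`. -/
def total (M : Grid → ℝ) : ℝ := ∑ k, M k

/-- Up-sets of the grid. -/
def IsUp (A : Finset Grid) : Prop := ∀ ⦃k k' : Grid⦄, k ≤ k' → k ∈ A → k' ∈ A

/-- Down-sets of the grid. -/
def IsDown (A : Finset Grid) : Prop := ∀ ⦃k k' : Grid⦄, k' ≤ k → k ∈ A → k' ∈ A

/-- The cells with `v ≠ T`: the avoidance event `t ↮ {s, v}`. -/
def R : Finset Grid := Finset.univ.filter (fun k => k.2 ≠ 0)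

/-- The cells with `u ≠ S`: the avoidance event `s ↮ {t, u}`. -/
def R' : Finset Grid := Finset.univ.filter (fun k => k.1 ≠ 2)

/-- The double-hit cell `(S, T)`. -/
def ST : Grid := (2, 0)

/-- Every cell with `v = T` lies below `(S, T)`. -/
lemma le_ST_of_snd_eq_zero : ∀ k : Grid, k.2 = 0 → k ≤ ST := by decide

/-- Every cell with `u = S` lies above `(S, T)`. -/
lemma ST_le_of_fst_eq_two : ∀ k : Grid, k.1 = 2 → ST ≤ k := by decide

/-- An up-set not containing `(S, T)` lies inside `{v ≠ T}`. -/
lemma up_subset_R {A : Finset Grid} (hA : IsUp A) (h : ST ∉ A) : A ⊆ R := by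
  intro k hk
  simp only [R, Finset.mem_filter, Finset.mem_univ, true_and]
  intro h2
  exact h (hA (le_ST_of_snd_eq_zero k h2) hk)

/-- A down-set not containing `(S, T)` lies inside `{u ≠ S}`. -/
lemma down_subset_R' {A : Finset Grid} (hA : IsDown A) (h : ST ∉ A) : A ⊆ R' := by
  intro k hk
  simp only [R', Finset.mem_filter, Finset.mem_univ, true_and]
  intro h1
  exact h (hA (ST_le_of_fst_eq_two k h1) hk)

/-- The complement of an up-set is a down-set. -/
lemma isDown_compl {A : Finset Grid} (hA : IsUp A) : IsDown (Finset.univ \ A) := by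
  intro k k' hle hk
  simp only [Finset.mem_sdiff, Finset.mem_univ, true_and] at hk ⊢
  exact fun hk' => hk (hA hle hk')

variable {M : Grid → ℝ}

/-- Masses are nonnegative. -/
lemma mass_nonneg (hM : ∀ k, 0 ≤ M k) (A : Finset Grid) : 0 ≤ mass M A :=
  Finset.sum_nonneg fun k _ => hM k

/-- `mass A ≤ Z`. -/
lemma mass_le_total (hM : ∀ k, 0 ≤ M k) (A : Finset Grid) : mass M A ≤ total M :=
  Finset.sum_le_sum_of_subset_of_nonneg (Finset.subset_univ A) fun k _ _ => hM k

/-- `0 ≤ Z`. -/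
lemma total_nonneg (hM : ∀ k, 0 ≤ M k) : 0 ≤ total M := Finset.sum_nonneg fun k _ => hM k

/-- Masses of a subset and of its complement in a filter add up. -/
lemma mass_filter_add (p : Grid → Prop) [DecidablePred p] :
    mass M (Finset.univ.filter p) + mass M (Finset.univ.filter (fun k => ¬ p k)) = total M := by
  unfold mass total
  rw [Finset.sum_filter_add_sum_filter_not]

/-- `M(R) + M(S,T) ≤ Z`. -/
lemma mass_R_add_le (hM : ∀ k, 0 ≤ M k) : mass M R + M ST ≤ total M := by
  have h := mass_filter_add (M := M) (fun k : Grid => k.2 ≠ 0)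
  have hST : M ST ≤ mass M (Finset.univ.filter (fun k : Grid => ¬ k.2 ≠ 0)) := by
    unfold mass
    refine Finset.single_le_sum (fun k _ => hM k) ?_
    simp [ST]
  unfold R
  linarith

/-- `M(R′) + M(S,T) ≤ Z`. -/
lemma mass_R'_add_le (hM : ∀ k, 0 ≤ M k) : mass M R' + M ST ≤ total M := by
  have h := mass_filter_add (M := M) (fun k : Grid => k.1 ≠ 2)
  have hST : M ST ≤ mass M (Finset.univ.filter (fun k : Grid => ¬ k.1 ≠ 2)) := by
    unfold mass
    refine Finset.single_le_sum (fun k _ => hM k) ?_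
    simp [ST]
  unfold R'
  linarith

/-- The mass of a complement. -/
lemma mass_compl (A : Finset Grid) : mass M (Finset.univ \ A) = total M - mass M A := by
  unfold mass total
  rw [eq_sub_iff_add_eq, Finset.sum_sdiff (Finset.subset_univ A)]

/-- Inclusion–exclusion for the intersection of two complements. -/
lemma mass_compl_inter (A B : Finset Grid) :
    mass M ((Finset.univ \ A) ∩ (Finset.univ \ B)) =
      total M - mass M A - mass M B + mass M (A ∩ B) := by
  rw [← Finset.sdiff_union_distrib, mass_compl]
  have := Finset.sum_union_inter (s₁ := A) (s₂ := B) (f := M)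
  unfold mass
  linarith

/-- The core estimate: from `a·b ≤ c·r`, `r + m ≤ Z`, `0 ≤ c, m, Z` one gets
`(Z + m)·a·b ≤ Z²·c`. -/
lemma core_estimate {a b c r m Z : ℝ} (h1 : a * b ≤ c * r) (h2 : r + m ≤ Z) (hc : 0 ≤ c)
    (hm : 0 ≤ m) (hZ : 0 ≤ Z) : (Z + m) * (a * b) ≤ Z ^ 2 * c := by
  have h3 : (Z + m) * (a * b) ≤ (Z + m) * (c * r) :=
    mul_le_mul_of_nonneg_left h1 (by linarith)
  have h4 : (Z + m) * (c * r) ≤ (Z + m) * (c * (Z - m)) := by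
    apply mul_le_mul_of_nonneg_left _ (by linarith)
    exact mul_le_mul_of_nonneg_left (by linarith) hc
  have h5 : (Z + m) * (c * (Z - m)) = Z ^ 2 * c - m ^ 2 * c := by ring
  nlinarith [sq_nonneg m, mul_nonneg (sq_nonneg m) hc]

/-- **The single-exclusion union row from conditional positive association.** For up-sets
`A, B` of the status grid,
`Z·(Z·M(A∩B) − M(A)M(B)) − M(S,T)·(Z·1_A(S,T) − M(A))·(Z·1_B(S,T) − M(B)) ≥ 0`
follows from (Q) positive association of up-sets under `M`, (R) positive association of up-sets
inside `{v ≠ T}` under `M|_R`, and (R′) positive association of down-sets inside `{u ≠ S}` under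
`M|_{R′}`. -/
theorem single_exclusion_nonneg (hM : ∀ k, 0 ≤ M k)
    (hQ : ∀ A B : Finset Grid, IsUp A → IsUp B →
      mass M A * mass M B ≤ mass M (A ∩ B) * total M)
    (hR : ∀ A B : Finset Grid, IsUp A → IsUp B → A ⊆ R → B ⊆ R →
      mass M A * mass M B ≤ mass M (A ∩ B) * mass M R)
    (hR' : ∀ A B : Finset Grid, IsDown A → IsDown B → A ⊆ R' → B ⊆ R' →
      mass M A * mass M B ≤ mass M (A ∩ B) * mass M R')
    {A B : Finset Grid} (hA : IsUp A) (hB : IsUp B) :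
    0 ≤ total M * (total M * mass M (A ∩ B) - mass M A * mass M B) -
      M ST * (total M * (if ST ∈ A then 1 else 0) - mass M A) *
        (total M * (if ST ∈ B then 1 else 0) - mass M B) := by
  have hZ := total_nonneg hM
  have hST := hM ST
  have hmA := mass_nonneg hM A
  have hmB := mass_nonneg hM B
  have hAZ := mass_le_total hM A
  have hBZ := mass_le_total hM B
  have hcov := hQ A B hA hB
  by_cases hA2 : ST ∈ A <;> by_cases hB2 : ST ∈ B
  · -- both contain `(S, T)`: pass to the complements, down-sets inside `{u ≠ S}`
    simp only [hA2, hB2, if_true, mul_one]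
    have hA' := isDown_compl hA
    have hB' := isDown_compl hB
    have hA'R : Finset.univ \ A ⊆ R' := down_subset_R' hA' (by simp [hA2])
    have hB'R : Finset.univ \ B ⊆ R' := down_subset_R' hB' (by simp [hB2])
    have key := hR' _ _ hA' hB' hA'R hB'R
    rw [mass_compl, mass_compl, mass_compl_inter] at key
    have hc := mass_nonneg hM ((Finset.univ \ A) ∩ (Finset.univ \ B))
    rw [mass_compl_inter] at hc
    have est := core_estimate key (mass_R'_add_le hM) hc hST hZ
    nlinarith [est]
  · -- mixed signs: the subtracted term is `≤ 0`
    simp only [hA2, hB2, if_true, if_false, mul_one, mul_zero, zero_sub]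
    have : 0 ≤ M ST * (total M - mass M A) * mass M B :=
      mul_nonneg (mul_nonneg hST (by linarith)) hmB
    nlinarith
  · simp only [hA2, hB2, if_true, if_false, mul_one, mul_zero, zero_sub]
    have : 0 ≤ M ST * mass M A * (total M - mass M B) :=
      mul_nonneg (mul_nonneg hST hmA) (by linarith)
    nlinarith
  · -- neither contains `(S, T)`: both lie inside `{v ≠ T}`
    simp only [hA2, hB2, if_false, mul_zero, zero_sub]
    have hAR : A ⊆ R := up_subset_R hA hA2
    have hBR : B ⊆ R := up_subset_R hB hB2
    have key := hR A B hA hB hAR hBR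
    have hc := mass_nonneg hM (A ∩ B)
    have est := core_estimate key (mass_R_add_le hM) hc hST hZ
    nlinarith [est]

end UnionRowMech

end Summit.Ventures.PercRepro2
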